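import Summits.Schanuel.Schanuel.Theorems.ZilberEacSuperellipticPolyFibres
import Summits.Schanuel.Schanuel.Theorems.ZilberEacBranchCycleMaster
import HarnessLib

/-!
# Arbitrary base branches, XXXVIII: FIBRE CURVES `F(x₀, y₀) = 0` over the cyclic covers
# `x₁^k = P(x₀)`, `k ≥ 3` — every branch at infinity of `F` (finite, zero or pole value) gives density

HONEST FRAMING.  Cell `pub-schanuel` (Zilber's Exponential-Algebraic Closedness, case ladder;
host summit Schanuel), seat 2, gen 29.  Files XXXIII–XXXVII treated GRAPH fibres over
`C : x₁^k = P(x₀)`.  Here the fibre is an arbitrary irreducible relation `F(x₀, y₀) = 0` of positive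
`y₀`-degree, and `S` is any irreducible closed surface (dimension `≤ 2`) containing the cylinder over
the fibre product `C ×_{x₀} {F = 0}` (the style of file V).  Newton–Puiseux (file LXXII) gives, at
every root `θ` of the top `x₀`-row `T` of `F`, a branch `x₀ = t^{-k_F}`, `y₀ = ψ(t) → θ`; combined
with a sheet `x₀ = s^{-k}`, `x₁ = ζU₀^{1/k}s^{-M}` of `C` along `s = σ^{k_F}`, `t = σ^k`
(**`unprojectedDense_superelliptic_sheets_finite_ram`**, **`…_pole_ram`**: the dispatchers of file
XXXVII with an extra ramification).  For `k ≥ 3` a non-real sheet exists (file XXXIV), so: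
`θ ≠ 0` ⟹ growth (file XIX); `θ = 0` ⟹ `ψ = t^j·g`, a ZERO fibre value, ⟹ the pole route (files
XXXII/XXXVI).  Hence **`unprojectedDense_superelliptic_fibreCurve`**: `k ≥ 3`, `P` monic of degree
`≥ 1`, `F` irreducible of positive `y₀`-degree with `F(x₀, 0) ≢ 0` and a non-constant top row ⟹
every such `S` has Zariski-dense exponential points — no residue class, no circle, no zero branch at
a finite point needed (compare file V, which needs `M ≥ k + 1` AND a finite zero/pole branch).
`k = 2` keeps its circle (file XXX) and is not treated here.  Decided instances of an OPEN question
(Mantova–Masser, PLMS 2024 §1 p. 5); EC(3,2) OPEN; NOT Schanuel's conjecture; EAC ⇏ SC.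
-/

noncomputable section

open Filter Topology Set Complex
open Literature.NumberTheory.Transcendental Literature.ModelTheory.Zilber
open Literature.ModelTheory.ExponentialFields

set_option linter.dupNamespace false

namespace Summit.Schanuel.Schanuel.Theorems

section Superelliptic

variable (P : Polynomial ℂ)

/-! ## Part A. Dispatchers with an extra ramification `N` (for `k ≥ 3`) -/

/-- **Finite nonzero fibre values on a ramified sheet, `k ≥ 3`.**  If for every sheet `(ζ, Φ)` of
`x₁^k = P(x₀)` at infinity there are `N ≥ 1` and `ψ` analytic with `ψ(0) ≠ 0` such that the cylinder
germ `((σ^{Nk})^{-1}, Φ(σ^N)σ^{-NM}, ψ(σ), e^{x₁})` lies in `S`, then `S` is dense (growth on a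
non-real sheet). [cite: MantovaMasser2023, §1 Further remarks, p. 5 (the question, open in general)]
(new) -/
theorem unprojectedDense_superelliptic_sheets_finite_ram {S : Set (Fin 2 ⊕ Fin 2 → ℂ)}
    (hS : IsIrreducibleClosed ℂ S) (hdim : zariskiDim ℂ S ≤ (2 : ℕ)) {k : ℕ} (hk : 3 ≤ k)
    (hP : P.Monic) (hM : 1 ≤ P.natDegree)
    (hfib : ∀ (ζ : ℂ) (Φ : ℂ → ℂ), ζ ^ k = 1 → AnalyticAt ℂ Φ 0 → Φ 0 = ζ →
      (∀ᶠ s in 𝓝[≠] (0 : ℂ), (Φ s * (s ^ P.natDegree)⁻¹) ^ k - P.eval (s ^ k)⁻¹ = 0) →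
      ∃ (N : ℕ) (ψ : ℂ → ℂ), 1 ≤ N ∧ AnalyticAt ℂ ψ 0 ∧ ψ 0 ≠ 0 ∧
        ∀ᶠ σ in 𝓝[≠] (0 : ℂ), (Sum.elim ![(σ ^ (N * k))⁻¹, Φ (σ ^ N) * (σ ^ (N * P.natDegree))⁻¹]
          ![ψ σ, Complex.exp (Φ (σ ^ N) * (σ ^ (N * P.natDegree))⁻¹)] : Fin 2 ⊕ Fin 2 → ℂ) ∈ S) :
    UnprojectedDense S := by
  have hk1 : 1 ≤ k := by omega
  obtain ⟨ζ, z, hζ, hz, hre⟩ := exists_sheet_direction hk P.natDegree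
  obtain ⟨Φ, hΦan, hΦ0, hsheet⟩ := superelliptic_sheet_facts P hk1 hP hζ
  obtain ⟨N, ψ, hN, hψ, hψ0, hgerm⟩ := hfib ζ Φ hζ hΦan hΦ0 hsheet
  obtain ⟨zt, hzt⟩ := IsAlgClosed.exists_pow_nat_eq z (by omega : 0 < N)
  have hΦN : AnalyticAt ℂ (fun σ : ℂ => Φ (σ ^ N)) 0 :=
    hΦan.comp_of_eq (analyticAt_id.pow N) (by simp [zero_pow (by omega : N ≠ 0)])
  refine unprojectedDense_branch_growth_of_exists_direction hS hdim (Nat.mul_pos hN hk1 |> fun h => h)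
    (Nat.mul_pos hN hM |> fun h => h) hψ hψ0 rfl hΦN ⟨zt, ?_, ?_⟩ hgerm
  · rw [pow_mul, hzt, hz]
  · simp only [zero_pow (by omega : N ≠ 0), hΦ0]
    rw [pow_mul, hzt]
    exact hre

/-- **Pole / zero fibre values on a ramified sheet** (`M ≠ k ∨ k ≥ 3`).  If for every sheet
`(ζ, Φ)` (with its flatness `‖Φ − ζ‖ = O(‖s‖^k)`) there are `N ≥ 1`, `ψ` analytic with `ψ(0) ≠ 0`
and `L ≠ 0` with the germ `((σ^{Nk})^{-1}, Φ(σ^N)σ^{-NM}, ψ(σ)σ^L, e^{x₁})` in `S`, then `S` is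
dense. [cite: MantovaMasser2023, §1 Further remarks, p. 5 (the question, open in general)] (new) -/
theorem unprojectedDense_superelliptic_sheets_pole_ram {S : Set (Fin 2 ⊕ Fin 2 → ℂ)}
    (hS : IsIrreducibleClosed ℂ S) (hdim : zariskiDim ℂ S ≤ (2 : ℕ)) {k : ℕ} (hk : 1 ≤ k)
    (hP : P.Monic) (hM : 1 ≤ P.natDegree) (hexc : P.natDegree ≠ k ∨ 3 ≤ k)
    (hfib : ∀ (ζ : ℂ) (Φ : ℂ → ℂ), ζ ^ k = 1 → AnalyticAt ℂ Φ 0 → Φ 0 = ζ →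
      (∃ K : ℝ, ∀ᶠ s in 𝓝 (0 : ℂ), ‖Φ s - Φ 0‖ ≤ K * ‖s‖ ^ k) →
      (∀ᶠ s in 𝓝[≠] (0 : ℂ), (Φ s * (s ^ P.natDegree)⁻¹) ^ k - P.eval (s ^ k)⁻¹ = 0) →
      ∃ (N : ℕ) (ψ : ℂ → ℂ) (L : ℤ), 1 ≤ N ∧ AnalyticAt ℂ ψ 0 ∧ ψ 0 ≠ 0 ∧ L ≠ 0 ∧
        ∀ᶠ σ in 𝓝[≠] (0 : ℂ), (Sum.elim ![(σ ^ (N * k))⁻¹, Φ (σ ^ N) * (σ ^ (N * P.natDegree))⁻¹]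
          ![ψ σ * σ ^ L, Complex.exp (Φ (σ ^ N) * (σ ^ (N * P.natDegree))⁻¹)] :
            Fin 2 ⊕ Fin 2 → ℂ) ∈ S) :
    UnprojectedDense S := by
  set M := P.natDegree with hMdef
  have hk0 : k ≠ 0 := by omega
  -- a sheet with its flatness, composed with `σ ↦ σ^N`
  have comp : ∀ {ζ : ℂ} {Φ : ℂ → ℂ} {N : ℕ}, 1 ≤ N → AnalyticAt ℂ Φ 0 → Φ 0 = ζ →
      (∃ K : ℝ, ∀ᶠ s in 𝓝 (0 : ℂ), ‖Φ s - Φ 0‖ ≤ K * ‖s‖ ^ k) →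
      AnalyticAt ℂ (fun σ : ℂ => Φ (σ ^ N)) 0 ∧ Φ ((0 : ℂ) ^ N) = ζ ∧
        ∃ K : ℝ, ∀ᶠ σ in 𝓝 (0 : ℂ), ‖Φ (σ ^ N) - Φ ((0 : ℂ) ^ N)‖ ≤ K * ‖σ‖ ^ (N * k) := by
    intro ζ Φ N hN hΦan hΦ0 hflat
    have hN0 : N ≠ 0 := by omega
    have hpow : AnalyticAt ℂ (fun σ : ℂ => σ ^ N) 0 := analyticAt_id.pow N
    have hpow0 : Tendsto (fun σ : ℂ => σ ^ N) (𝓝 0) (𝓝 0) := by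
      have := hpow.continuousAt.tendsto
      simpa [zero_pow hN0] using this
    refine ⟨hΦan.comp_of_eq hpow (by simp [zero_pow hN0]), by simp [zero_pow hN0, hΦ0], ?_⟩
    obtain ⟨K, hK⟩ := hflat
    refine ⟨K, ?_⟩
    filter_upwards [hpow0.eventually hK] with σ hσ
    rw [zero_pow hN0]
    simpa only [norm_pow, ← pow_mul] using hσ
  by_cases hkM : k < M
  · obtain ⟨Φ, hΦan, hΦ0, hflat, hsheet⟩ := superelliptic_sheet_facts_flat P hk hP hM (one_pow k)
    obtain ⟨N, ψ, L, hN, hψ, hψ0, hL, hgerm⟩ := hfib 1 Φ (one_pow k) hΦan hΦ0 hflat hsheet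
    obtain ⟨hΦN, hΦN0, hflatN⟩ := comp hN hΦan hΦ0 hflat
    refine unprojectedDense_branch_poleFibre_of_flat hS hdim (Nat.mul_pos hN hk |> fun h => h)
      (Nat.mul_lt_mul_left (by omega) |>.2 hkM) hL hψ hψ0 hΦN (by rw [hΦN0]; exact one_ne_zero)
      ?_ hgerm
    simpa only using hflatN
  · -- `M ≤ k`: a non-real sheet when `k ≥ 3`, else `(k, M) = (2, 1)` off the residue class
    have hsheet_dir : 3 ≤ k → UnprojectedDense S := by
      intro hk3
      obtain ⟨ζ, z, hζ, hz, hre⟩ := exists_sheet_direction hk3 M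
      obtain ⟨Φ, hΦan, hΦ0, hflat, hsheet⟩ := superelliptic_sheet_facts_flat P hk hP hM hζ
      obtain ⟨N, ψ, L, hN, hψ, hψ0, -, hgerm⟩ := hfib ζ Φ hζ hΦan hΦ0 hflat hsheet
      obtain ⟨hΦN, hΦN0, -⟩ := comp hN hΦan hΦ0 hflat
      obtain ⟨zt, hzt⟩ := IsAlgClosed.exists_pow_nat_eq z (by omega : 0 < N)
      refine unprojectedDense_branch_poleFibre_of_exists_direction hS hdim
        (Nat.mul_pos hN hk |> fun h => h) (Nat.mul_pos hN hM |> fun h => h) L hψ hψ0 hΦN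
        ⟨zt, ?_, ?_⟩ hgerm
      · rw [pow_mul, hzt, hz]
      · rw [hΦN0, pow_mul, hzt]
        exact hre
    rcases hexc with hne | hk3
    · by_cases hk3 : 3 ≤ k
      · exact hsheet_dir hk3
      · have hk2 : k = 2 := by omega
        have hM1 : M = 1 := by omega
        obtain ⟨Φ, hΦan, hΦ0, hflat, hsheet⟩ := superelliptic_sheet_facts_flat P hk hP hM (one_pow k)
        obtain ⟨N, ψ, L, hN, hψ, hψ0, -, hgerm⟩ := hfib 1 Φ (one_pow k) hΦan hΦ0 hflat hsheet
        obtain ⟨hΦN, hΦN0, -⟩ := comp hN hΦan hΦ0 hflat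
        refine unprojectedDense_branch_poleFibre_of_not_residue hS hdim
          (Nat.mul_pos hN hk |> fun h => h) (Nat.mul_pos hN hM |> fun h => h) ?_ L hψ hψ0 hΦN hΦN0
          hgerm
        rw [hM1, hk2]
        rintro ⟨-, h4⟩
        have hN0 : 0 < N := hN
        rw [show 2 * (N * 1) / (N * 2) = 1 from by
          rw [Nat.mul_one, Nat.mul_comm N 2]; exact Nat.div_self (by omega)] at h4
        omega
    · exact hsheet_dir hk3

/-! ## Part B. Fibre curves over `x₁^k = P(x₀)`, `k ≥ 3` -/

/-- A Puiseux branch `y₀ = ψ(t)` of `F` at `x₀ = t^{-e} → ∞` is not identically zero when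
`F(x₀, 0) ≢ 0`. [folklore] -/
theorem fibreCycle_not_eventually_zero (F : Polynomial (Polynomial ℂ)) (hF00 : F.coeff 0 ≠ 0)
    {e : ℕ} (he : 1 ≤ e) {ψ : ℂ → ℂ}
    (hbranch : ∀ᶠ t in 𝓝[≠] (0 : ℂ), (F.map (Polynomial.evalRingHom (t ^ e)⁻¹)).eval (ψ t) = 0) :
    ¬ ∀ᶠ t in 𝓝 (0 : ℂ), ψ t = 0 := by
  intro hzero
  set q : Polynomial ℂ := F.coeff 0 with hq
  obtain ⟨U, hUan, hU0, hUeval⟩ :=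
    exists_polarForm_eval q (U := fun _ : ℂ => (1 : ℂ)) analyticAt_const he
  rw [one_pow, mul_one] at hU0
  have hUne : ∀ᶠ t in 𝓝 (0 : ℂ), U t ≠ 0 :=
    hUan.continuousAt.eventually_ne (by rw [hU0]; exact Polynomial.leadingCoeff_ne_zero.2 hF00)
  have hcontra : ∀ᶠ t in 𝓝[≠] (0 : ℂ), False := by
    filter_upwards [hbranch, nhdsWithin_le_nhds hzero, nhdsWithin_le_nhds hUne, self_mem_nhdsWithin]
      with t ht hψt hUt (ht0 : t ≠ 0)
    rw [hψt, ← Polynomial.coeff_zero_eq_eval_zero, Polynomial.coeff_map, ← hq,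
      Polynomial.coe_evalRingHom] at ht
    have hU := hUeval t ht0
    rw [one_mul, inv_pow] at hU
    rw [hU] at ht
    exact (mul_ne_zero hUt (pow_ne_zero _ (inv_ne_zero ht0))) ht
  exact hcontra.exists.elim fun _ h => h

/-- **Fibre curves over `x₁^k = P(x₀)`, `k ≥ 3`.**  `S` irreducible closed of dimension `≤ 2`
containing every point `(x₀, x₁, y₀, e^{x₁})` with `x₁^k = P(x₀)` and `F(x₀, y₀) = 0`, where `P` is
monic of degree `≥ 1`, `F ∈ ℂ[x₀][y₀]` is irreducible of positive `y₀`-degree with `F(x₀, 0) ≢ 0`,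
rows of degree `≤ N` in `x₀` and top row `T ≠ 0` having a root `θ` (finite value `θ ≠ 0`: growth on
a non-real sheet; `θ = 0`: a zero fibre value, the pole route).  Then the exponential points are
Zariski dense in `S`. [cite: MantovaMasser2023, §1 Further remarks, p. 5 (the question, open in
general)] (new) -/
theorem unprojectedDense_superelliptic_fibreCurve {S : Set (Fin 2 ⊕ Fin 2 → ℂ)}
    (hS : IsIrreducibleClosed ℂ S) (hdim : zariskiDim ℂ S ≤ (2 : ℕ)) {k : ℕ} (hk : 3 ≤ k)
    (hP : P.Monic) (hM : 1 ≤ P.natDegree)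
    (F : Polynomial (Polynomial ℂ)) (hFirr : Irreducible F) (hF1 : F.natDegree ≠ 0)
    (hF00 : F.coeff 0 ≠ 0) (N : ℕ) (hN : ∀ j, (F.coeff j).natDegree ≤ N)
    (T : Polynomial ℂ) (hT : ∀ j, T.coeff j = (F.coeff j).coeff N) (hT0 : T ≠ 0) {θ : ℂ}
    (hTθ : T.IsRoot θ)
    (hsub : ∀ x₀ x₁ y₀ : ℂ, x₁ ^ k - P.eval x₀ = 0 →
      (F.map (Polynomial.evalRingHom x₀)).eval y₀ = 0 →
      (Sum.elim ![x₀, x₁] ![y₀, Complex.exp x₁] : Fin 2 ⊕ Fin 2 → ℂ) ∈ S) :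
    UnprojectedDense S := by
  have hk1 : 1 ≤ k := by omega
  have hk0 : k ≠ 0 := by omega
  obtain ⟨e, ψ, he, hψan, hψ0, hbranch⟩ := exists_fibreCycle_puiseux F hFirr hF1 N hN T hT hT0 hTθ
  have he0 : e ≠ 0 := by omega
  -- the fibre branch in the common parameter: `t = σ^k`, base parameter `s = σ^e`
  have hψk : AnalyticAt ℂ (fun σ : ℂ => ψ (σ ^ k)) 0 :=
    hψan.comp_of_eq (analyticAt_id.pow k) (by simp [zero_pow hk0])
  have hbranchk : ∀ᶠ σ in 𝓝[≠] (0 : ℂ),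
      (F.map (Polynomial.evalRingHom (σ ^ (e * k))⁻¹)).eval (ψ (σ ^ k)) = 0 := by
    filter_upwards [(tendsto_pow_punctured_nhds_zero hk1).eventually hbranch] with σ hσ
    rw [mul_comm, pow_mul]
    exact hσ
  -- membership of the combined germ, for any sheet `Φ`
  have germ_of_sheet : ∀ {Φ : ℂ → ℂ} {χ : ℂ → ℂ},
      (∀ᶠ s in 𝓝[≠] (0 : ℂ), (Φ s * (s ^ P.natDegree)⁻¹) ^ k - P.eval (s ^ k)⁻¹ = 0) →
      (∀ᶠ σ in 𝓝[≠] (0 : ℂ), χ σ = ψ (σ ^ k)) →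
      ∀ᶠ σ in 𝓝[≠] (0 : ℂ), (Sum.elim ![(σ ^ (e * k))⁻¹, Φ (σ ^ e) * (σ ^ (e * P.natDegree))⁻¹]
        ![χ σ, Complex.exp (Φ (σ ^ e) * (σ ^ (e * P.natDegree))⁻¹)] : Fin 2 ⊕ Fin 2 → ℂ) ∈ S := by
    intro Φ χ hsheet hχ
    filter_upwards [(tendsto_pow_punctured_nhds_zero he).eventually hsheet, hbranchk, hχ]
      with σ hs hb hχσ
    have h := hsub ((σ ^ (e * k))⁻¹) (Φ (σ ^ e) * (σ ^ (e * P.natDegree))⁻¹) (χ σ)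
      (by rw [pow_mul, pow_mul]; exact hs) (by rw [hχσ]; exact hb)
    simpa using h
  by_cases hθ0 : θ = 0
  · -- zero fibre value: `ψ = t^j g`, `g(0) ≠ 0`, `j ≥ 1`
    have hne := fibreCycle_not_eventually_zero F hF00 he hbranch
    obtain ⟨j, g, hgan, hg0, hψg⟩ := (hψan.exists_eventuallyEq_pow_smul_nonzero_iff).2 hne
    have hj : 1 ≤ j := by
      rcases Nat.eq_zero_or_pos j with rfl | hj
      · exfalso
        have h := hψg.self_of_nhds
        rw [pow_zero, one_smul, hψ0, hθ0] at h
        exact hg0 h.symm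
      · exact hj
    refine unprojectedDense_superelliptic_sheets_pole_ram P hS hdim hk1 hP hM (Or.inr hk) ?_
    intro ζ Φ hζ hΦan hΦ0 _ hsheet
    have hgk : AnalyticAt ℂ (fun σ : ℂ => g (σ ^ k)) 0 :=
      hgan.comp_of_eq (analyticAt_id.pow k) (by simp [zero_pow hk0])
    refine ⟨e, fun σ => g (σ ^ k), ((k * j : ℕ) : ℤ), he, hgk, by simpa [zero_pow hk0] using hg0,
      by exact_mod_cast Nat.mul_ne_zero hk0 (by omega), ?_⟩
    refine germ_of_sheet hsheet ?_
    have hpow0 : Tendsto (fun σ : ℂ => σ ^ k) (𝓝[≠] (0 : ℂ)) (𝓝 0) :=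
      (tendsto_pow_punctured_nhds_zero hk1).mono_right nhdsWithin_le_nhds
    filter_upwards [hpow0.eventually hψg] with σ hσ
    rw [hσ, sub_zero, smul_eq_mul, zpow_natCast, pow_mul, mul_comm]
  · -- finite nonzero fibre value: growth on a non-real sheet
    refine unprojectedDense_superelliptic_sheets_finite_ram P hS hdim hk hP hM ?_
    intro ζ Φ hζ hΦan hΦ0 hsheet
    exact ⟨e, fun σ => ψ (σ ^ k), he, hψk, by simpa [zero_pow hk0, hψ0] using hθ0,
      germ_of_sheet hsheet (Eventually.of_forall fun σ => rfl)⟩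

/-- **Coordinate version**: `S ⊇ {x₁^k = P(x₀), F(x₀, y₀) = 0} × {y₁ = e^{x₁}}` with `F` given by
its value function. [cite: MantovaMasser2023, §1 Further remarks, p. 5 (the question, open in
general)] (new) -/
theorem unprojectedDense_superelliptic_fibreCurve_of_nonconstant_topRow {S : Set (Fin 2 ⊕ Fin 2 → ℂ)}
    (hS : IsIrreducibleClosed ℂ S) (hdim : zariskiDim ℂ S ≤ (2 : ℕ)) {k : ℕ} (hk : 3 ≤ k)
    (hP : P.Monic) (hM : 1 ≤ P.natDegree)
    (F : Polynomial (Polynomial ℂ)) (hFirr : Irreducible F) (hF1 : F.natDegree ≠ 0)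
    (hF00 : F.coeff 0 ≠ 0) (N : ℕ) (hN : ∀ j, (F.coeff j).natDegree ≤ N)
    (T : Polynomial ℂ) (hT : ∀ j, T.coeff j = (F.coeff j).coeff N) (hTdeg : 0 < T.degree)
    (hsub : ∀ x₀ x₁ y₀ : ℂ, x₁ ^ k - P.eval x₀ = 0 →
      (F.map (Polynomial.evalRingHom x₀)).eval y₀ = 0 →
      (Sum.elim ![x₀, x₁] ![y₀, Complex.exp x₁] : Fin 2 ⊕ Fin 2 → ℂ) ∈ S) :
    UnprojectedDense S := by
  obtain ⟨θ, hθ⟩ := Complex.exists_root hTdeg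
  exact unprojectedDense_superelliptic_fibreCurve P hS hdim hk hP hM F hFirr hF1 hF00 N hN T hT
    (Polynomial.ne_zero_of_degree_gt hTdeg) hθ hsub

end Superelliptic

end Summit.Schanuel.Schanuel.Theorems

end
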